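import Mathlib.Tactic.IntervalCases
import Literature.Computability.Complexity.ParsimoniousThreeCNF
import Literature.Computability.Cryptography.FGProblemZoo
import HarnessLib

/-!
# Bringmann's curves: CNF-SAT inside the discrete Fréchet distance (the gadgets of FOCS 2014, §3.1)

The combinatorial half of K. Bringmann, *Why walking the dog takes time: Fréchet distance has no
strongly subquadratic algorithms unless SETH fails*, FOCS 2014, §3.1 ("The basic reduction,
discrete case"), with **integer coordinates**: the construction of the paper scaled by `3000`
(`1/3 ↦ 1000`, `1/2 ↦ 1500`, `ε = 1/1000 ↦ 3`, `1/5 ↦ 600`, `4/5 ↦ 2400`) and translated by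
`(1000, 2400)` into the nonnegative quadrant, threshold `τ = 3000` (`τ² = 9 000 000`), so that the
curves are instances of `DiscreteFrechetDecision` of the problem zoo and every distance comparison
is an exact integer comparison.

* Traversal lemmas for `discreteFrechet` (`FrechetRed.WidthLE τ P Q : discreteFrechet P Q ≤ τ`):
  the Eiter–Mannila recursion as an `iff`, advancing along one curve while standing on the other,
  parallel steps, entering a column, leaving a row;
* the points `s₁ t₁ r₁ c₁`, `s₂ t₂ r₂ s₂' t₂' c₂` (`s₂' = s₂*`, `t₂' = t₂*`) and the distance table
  of Lemma 3.3 (the pairs at distance `≤ τ`), Lemma 3.1;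
* half-assignments as numbers (`sat₁`, `sat₂`, `assignment`, `ofBits`) and
  `satisfiable_iff_exists` (a CNF on `≤ n₁ + n₂` variables is satisfiable iff some pair of
  half-assignments `A < 2^{n₁}`, `B < 2^{n₂}` satisfies every clause);
* the curves `curveP₁ φ n₁`, `curveP₂ φ n₁ n₂` (assignment gadgets `gadget₁`, `gadget₂`) and the
  main theorem `widthLE_curves_iff : discreteFrechet (curveP₁ φ n₁) (curveP₂ φ n₁ n₂) ≤ 3000 ↔
  φ.Satisfiable` for `numVars φ ≤ n₁ + n₂` (Lemmas 3.2, 3.4, 3.5), and the corresponding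
  `DiscreteFrechetDecision` instance `frechetInstance φ n₁ n₂` with its accepted output
  (`good_frechetInstance_iff`).

The word-RAM program that writes these curves and runs a hypothetical subquadratic decider on
them (the other half of the proof of Thm. 1.1) is in the companion files
`DiscreteFrechetReductionProgram.lean` / `DiscreteFrechetReduction.lean`.

## References

* K. Bringmann, FOCS 2014 (arXiv:1404.1448), §2 (discrete Fréchet distance, traversals), §3.1
  (Lemmas 3.1–3.5).
* T. Eiter, H. Mannila, *Computing discrete Fréchet distance*, Tech. report CD-TR 94/64 (1994)
  (the coupling recursion, `SequenceProblems.discreteFrechet`).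
-/

namespace Literature.Computability.FineGrained

open Cryptography Complexity

namespace FrechetRed

/-! ### Traversals of width `τ` -/

/-- `WidthLE τ P Q`: the discrete Fréchet distance of `P` and `Q` is at most `τ`, i.e. there is a
(discrete) traversal of `(P, Q)` of width `τ` (Bringmann 2014, §2). [cite: BringmannFOCS2014, §2] -/
def WidthLE (τ : ℝ) (P Q : List (ℤ × ℤ)) : Prop :=
  discreteFrechet P Q ≤ ((τ : ℝ) : WithTop ℝ)

/-- `Close τ p q`: the two vertices are within (Euclidean) distance `τ`. [folklore] -/
def Close (τ : ℝ) (p q : ℤ × ℤ) : Prop :=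
  intEuclideanDist p q ≤ τ

section traversal

variable {τ : ℝ}

/-- Two empty curves have width `τ` iff `0 ≤ τ` (junk case). [folklore] -/
theorem widthLE_nil_nil_iff : WidthLE τ [] [] ↔ 0 ≤ τ := by
  unfold WidthLE
  rw [discreteFrechet_nil_nil, ← WithTop.coe_zero, WithTop.coe_le_coe]

/-- No traversal of an empty and a nonempty curve. [folklore] -/
theorem not_widthLE_nil_cons (q : ℤ × ℤ) (qs : List (ℤ × ℤ)) : ¬ WidthLE τ [] (q :: qs) := by
  simp [WidthLE]

/-- No traversal of a nonempty and an empty curve. [folklore] -/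
theorem not_widthLE_cons_nil (p : ℤ × ℤ) (ps : List (ℤ × ℤ)) : ¬ WidthLE τ (p :: ps) [] := by
  simp [WidthLE]

/-- A traversal of `([], Q)` exists only for `Q = []`. [folklore] -/
theorem eq_nil_of_widthLE_nil_left {Q : List (ℤ × ℤ)} (h : WidthLE τ [] Q) : Q = [] := by
  cases Q with
  | nil => rfl
  | cons q qs => exact absurd h (not_widthLE_nil_cons q qs)

/-- A traversal of `(P, [])` exists only for `P = []`. [folklore] -/
theorem eq_nil_of_widthLE_nil_right {P : List (ℤ × ℤ)} (h : WidthLE τ P []) : P = [] := by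
  cases P with
  | nil => rfl
  | cons p ps => exact absurd h (not_widthLE_cons_nil p ps)

/-- A traversal of width `τ` of two nonempty curves has its second curve nonempty. [folklore] -/
theorem ne_nil_of_widthLE_cons {p : ℤ × ℤ} {ps Q : List (ℤ × ℤ)} (h : WidthLE τ (p :: ps) Q) :
    Q ≠ [] := by
  rintro rfl; exact not_widthLE_cons_nil p ps h

/-- **The Eiter–Mannila recursion as an equivalence**: a traversal of width `τ` of two nonempty
curves couples the two first vertices (which must be close) and then advances in both curves, in
the first only, or in the second only (Eiter–Mannila 1994, §3; Bringmann 2014, §2).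
[cite: BringmannFOCS2014, §2] -/
theorem widthLE_cons_cons_iff {p q : ℤ × ℤ} {ps qs : List (ℤ × ℤ)} :
    WidthLE τ (p :: ps) (q :: qs) ↔
      Close τ p q ∧ (WidthLE τ ps qs ∨ WidthLE τ ps (q :: qs) ∨ WidthLE τ (p :: ps) qs) := by
  unfold WidthLE Close
  rw [discreteFrechet_cons_cons, max_le_iff, min_le_iff, min_le_iff, WithTop.coe_le_coe]

/-- Closeness implies `0 ≤ τ`. [folklore] -/
theorem Close.nonneg {p q : ℤ × ℤ} (h : Close τ p q) : 0 ≤ τ :=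
  (intEuclideanDist_nonneg p q).trans h

/-- **Standing on `p`, advance along the second curve** through vertices close to `p`. [folklore] -/
theorem widthLE_cons_append {p : ℤ × ℤ} {ps qs₁ qs₂ : List (ℤ × ℤ)} (h₁ : ∀ q ∈ qs₁, Close τ p q)
    (h₂ : WidthLE τ (p :: ps) qs₂) : WidthLE τ (p :: ps) (qs₁ ++ qs₂) := by
  induction qs₁ with
  | nil => simpa using h₂
  | cons q qs₁ ih =>
    rw [List.cons_append, widthLE_cons_cons_iff]
    exact ⟨h₁ q (by simp), Or.inr (Or.inr (ih fun q' hq' => h₁ q' (by simp [hq'])))⟩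

/-- **Standing on `q`, advance along the first curve** through vertices close to `q`. [folklore] -/
theorem widthLE_append_cons {q : ℤ × ℤ} {ps₁ ps₂ qs : List (ℤ × ℤ)} (h₁ : ∀ p ∈ ps₁, Close τ p q)
    (h₂ : WidthLE τ ps₂ (q :: qs)) : WidthLE τ (ps₁ ++ ps₂) (q :: qs) := by
  induction ps₁ with
  | nil => simpa using h₂
  | cons p ps₁ ih =>
    rw [List.cons_append, widthLE_cons_cons_iff]
    exact ⟨h₁ p (by simp), Or.inr (Or.inl (ih fun p' hp' => h₁ p' (by simp [hp'])))⟩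

/-- **Parallel steps**: pointwise close prefixes of equal length can be traversed in lockstep.
[folklore] -/
theorem widthLE_append_append {ps₁ qs₁ P Q : List (ℤ × ℤ)} (h₁ : List.Forall₂ (Close τ) ps₁ qs₁)
    (h₂ : WidthLE τ P Q) : WidthLE τ (ps₁ ++ P) (qs₁ ++ Q) := by
  induction h₁ with
  | nil => simpa using h₂
  | cons hpq _ ih =>
    rw [List.cons_append, List.cons_append, widthLE_cons_cons_iff]
    exact ⟨hpq, Or.inl ih⟩

/-- Standing on the last vertex `q` of the second curve, finish the first curve. [folklore] -/
theorem widthLE_singleton_right {q : ℤ × ℤ} {P : List (ℤ × ℤ)} (hP : P ≠ [])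
    (h : ∀ p ∈ P, Close τ p q) : WidthLE τ P [q] := by
  induction P with
  | nil => exact absurd rfl hP
  | cons p ps ih =>
    rw [widthLE_cons_cons_iff]
    refine ⟨h p (by simp), ?_⟩
    cases ps with
    | nil => exact Or.inl (widthLE_nil_nil_iff.2 (h p (by simp)).nonneg)
    | cons p' ps' =>
      exact Or.inr (Or.inl (ih (List.cons_ne_nil _ _) fun x hx => h x (List.mem_cons_of_mem _ hx)))

/-- Standing on the last vertex `p` of the first curve, finish the second curve. [folklore] -/
theorem widthLE_singleton_left {p : ℤ × ℤ} {Q : List (ℤ × ℤ)} (hQ : Q ≠ [])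
    (h : ∀ q ∈ Q, Close τ p q) : WidthLE τ [p] Q := by
  induction Q with
  | nil => exact absurd rfl hQ
  | cons q qs ih =>
    rw [widthLE_cons_cons_iff]
    refine ⟨h q (by simp), ?_⟩
    cases qs with
    | nil => exact Or.inl (widthLE_nil_nil_iff.2 (h q (by simp)).nonneg)
    | cons q' qs' =>
      exact Or.inr (Or.inr (ih (List.cons_ne_nil _ _) fun x hx => h x (List.mem_cons_of_mem _ hx)))

/-- **Entering a column**: a traversal of `(P, qs₁ ++ q :: qs₂)` is, from the first moment it
stands on `q`, a traversal of a (nonempty) suffix of `P` and `q :: qs₂`. [folklore] -/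
theorem exists_suffix_of_widthLE_append_cons {P qs₁ qs₂ : List (ℤ × ℤ)} {q : ℤ × ℤ}
    (h : WidthLE τ P (qs₁ ++ q :: qs₂)) :
    ∃ P₁ P₂ : List (ℤ × ℤ), P = P₁ ++ P₂ ∧ WidthLE τ P₂ (q :: qs₂) := by
  induction qs₁ generalizing P with
  | nil => exact ⟨[], P, rfl, by simpa using h⟩
  | cons q' qs₁ ih =>
    induction P with
    | nil => exact absurd h (not_widthLE_nil_cons _ _)
    | cons p ps ihP =>
      rw [List.cons_append, widthLE_cons_cons_iff] at h
      obtain ⟨-, h | h | h⟩ := h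
      · obtain ⟨P₁, P₂, rfl, hP⟩ := ih h
        exact ⟨p :: P₁, P₂, rfl, hP⟩
      · obtain ⟨P₁, P₂, hps, hP⟩ := ihP h
        exact ⟨p :: P₁, P₂, by rw [hps]; rfl, hP⟩
      · exact ih h

/-- **Leaving a row**: a traversal of `(p :: ps, Q)` stands on `p` along a prefix `qs₁ ++ [q]` of
`Q` of vertices close to `p`, and then steps to the row of `ps`, diagonally or vertically.
[folklore] -/
theorem exists_split_of_widthLE_cons {p : ℤ × ℤ} {ps Q : List (ℤ × ℤ)} (h : WidthLE τ (p :: ps) Q) :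
    ∃ (qs₁ : List (ℤ × ℤ)) (q : ℤ × ℤ) (qs₂ : List (ℤ × ℤ)), Q = qs₁ ++ q :: qs₂ ∧
      (∀ q' ∈ qs₁, Close τ p q') ∧ Close τ p q ∧ (WidthLE τ ps (q :: qs₂) ∨ WidthLE τ ps qs₂) := by
  induction Q with
  | nil => exact absurd h (not_widthLE_cons_nil _ _)
  | cons q qs ih =>
    rw [widthLE_cons_cons_iff] at h
    obtain ⟨hc, h | h | h⟩ := h
    · exact ⟨[], q, qs, rfl, by simp, hc, Or.inr h⟩
    · exact ⟨[], q, qs, rfl, by simp, hc, Or.inl h⟩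
    · obtain ⟨qs₁, q', qs₂, rfl, h₁, hc', h'⟩ := ih h
      refine ⟨q :: qs₁, q', qs₂, rfl, ?_, hc', h'⟩
      intro x hx
      rcases List.mem_cons.1 hx with rfl | hx
      exacts [hc, h₁ x hx]

/-- **Lockstep is forced**: if the diagonal pairs of two equally long vertex lists may be close but
the two off-diagonal neighbours of every diagonal pair are not, then a traversal of width `τ` of
the two lists followed by arbitrary tails couples every diagonal pair (Bringmann 2014, proof of
Lemma 3.2). [cite: BringmannFOCS2014, Lemma 3.2 (proof)] -/
theorem forall_close_of_widthLE_append {L₁ L₂ π₁ π₂ : List (ℤ × ℤ)} (hlen : L₁.length = L₂.length)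
    (hoff : ∀ i (hi : i + 1 < L₁.length),
      ¬ Close τ (L₁[i + 1]) (L₂[i]'(by omega)) ∧ ¬ Close τ (L₁[i]) (L₂[i + 1]'(by omega)))
    (h : WidthLE τ (L₁ ++ π₁) (L₂ ++ π₂)) :
    ∀ i (hi : i < L₁.length), Close τ (L₁[i]) (L₂[i]'(by omega)) := by
  induction L₁ generalizing L₂ with
  | nil => intro i hi; simp at hi
  | cons a L₁ ih =>
    cases L₂ with
    | nil => simp at hlen
    | cons b L₂ =>
      simp only [List.length_cons, Nat.add_right_cancel_iff] at hlen
      rw [List.cons_append, List.cons_append, widthLE_cons_cons_iff] at h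
      obtain ⟨hab, h⟩ := h
      have htail : L₁ ≠ [] → WidthLE τ (L₁ ++ π₁) (L₂ ++ π₂) := by
        intro hne
        obtain ⟨a', L₁', rfl⟩ := List.exists_cons_of_ne_nil hne
        obtain ⟨b', L₂', rfl⟩ : ∃ (b' : ℤ × ℤ) (L₂' : List (ℤ × ℤ)), L₂ = b' :: L₂' := by
          cases L₂ with
          | nil => simp at hlen
          | cons b' L₂' => exact ⟨b', L₂', rfl⟩
        rcases h with h | h | h
        · exact h
        · rw [List.cons_append, List.cons_append, widthLE_cons_cons_iff] at h
          exact absurd h.1 (hoff 0 (by simp)).1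
        · rw [List.cons_append, List.cons_append, widthLE_cons_cons_iff] at h
          exact absurd h.1 (hoff 0 (by simp)).2
      intro i hi
      cases i with
      | zero => simpa using hab
      | succ i =>
        have hne : L₁ ≠ [] := List.ne_nil_of_length_pos (by simp only [List.length_cons] at hi; omega)
        have := ih hlen (fun j hj => hoff (j + 1) (by simpa using hj)) (htail hne) i
          (by simpa using hi)
        simpa using this

end traversal

/-! ### The points (Bringmann 2014, §3.1, scaled by `3000` and translated by `(1000, 2400)`) -/

/-- `s₁ = (-1/3, 1/5)`. [cite: BringmannFOCS2014, §3.1] -/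
def s₁ : ℤ × ℤ := (0, 3000)
/-- `t₁ = (1/3, 1/5)`. [cite: BringmannFOCS2014, §3.1] -/
def t₁ : ℤ × ℤ := (2000, 3000)
/-- `r₁ = (-1/3, 1/2)`, the start of an assignment gadget of the first curve.
[cite: BringmannFOCS2014, §3.1] -/
def r₁ : ℤ × ℤ := (0, 3900)
/-- `c₁ e b = c^e_{1,b} = (e/3, 1/2 ∓ ε)` (`e ∈ {0, 1}` the parity of the clause index, `b` = "the
half-assignment satisfies the clause", `-ε` for `b = true`). [cite: BringmannFOCS2014, §3.1] -/
def c₁ (e : ℕ) (b : Bool) : ℤ × ℤ := (1000 * (e : ℤ) + 1000, if b then 3897 else 3903)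
/-- `s₂ = (-1/3, 0)`. [cite: BringmannFOCS2014, §3.1] -/
def s₂ : ℤ × ℤ := (0, 2400)
/-- `t₂ = (1/3, 0)`. [cite: BringmannFOCS2014, §3.1] -/
def t₂ : ℤ × ℤ := (2000, 2400)
/-- `r₂ = (-1/3, -1/2)`, the start of an assignment gadget of the second curve.
[cite: BringmannFOCS2014, §3.1] -/
def r₂ : ℤ × ℤ := (0, 900)
/-- `s₂' = s₂* = (-1/3, -4/5)`. [cite: BringmannFOCS2014, §3.1] -/
def s₂' : ℤ × ℤ := (0, 0)
/-- `t₂' = t₂* = (1/3, -4/5)`. [cite: BringmannFOCS2014, §3.1] -/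
def t₂' : ℤ × ℤ := (2000, 0)
/-- `c₂ e b = c^e_{2,b} = (e/3, -1/2 ± ε)` (`+ε` for `b = true`). [cite: BringmannFOCS2014, §3.1] -/
def c₂ (e : ℕ) (b : Bool) : ℤ × ℤ := (1000 * (e : ℤ) + 1000, if b then 903 else 897)

/-- The squared threshold `τ² = 3000² = 9 000 000` (the paper's threshold `1`, scaled).
[cite: BringmannFOCS2014, §3.1] -/
def sqThreshold : ℕ := 9000000

/-- The squared Euclidean distance of two integer points. [folklore] -/
def sqDist (p q : ℤ × ℤ) : ℤ := (p.1 - q.1) ^ 2 + (p.2 - q.2) ^ 2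

/-- `Real.sqrt 9000000 = 3000`. [folklore] -/
theorem sqrt_sqThreshold : Real.sqrt (sqThreshold : ℝ) = 3000 := by
  rw [show ((sqThreshold : ℕ) : ℝ) = (3000 : ℝ) ^ 2 by norm_num [sqThreshold]]
  exact Real.sqrt_sq (by norm_num)

/-- Closeness at threshold `3000` is the integer comparison `sqDist p q ≤ 9 000 000`. [folklore] -/
theorem close_iff_sqDist (p q : ℤ × ℤ) : Close 3000 p q ↔ sqDist p q ≤ 9000000 := by
  unfold Close intEuclideanDist sqDist
  rw [show (3000 : ℝ) = Real.sqrt ((3000 : ℝ) ^ 2) from (Real.sqrt_sq (by norm_num)).symm,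
    Real.sqrt_le_sqrt_iff (by positivity)]
  constructor
  · intro h; exact_mod_cast h
  · intro h; exact_mod_cast h

/-! ### The distance table (Bringmann 2014, Lemmas 3.1 and 3.3) -/

/-- The vertices that occur in the first curve: `Q₁ = {s₁, t₁, r₁, c₁ e b}`. [cite: BringmannFOCS2014, §3.1] -/
def IsQ₁ (p : ℤ × ℤ) : Prop :=
  p = s₁ ∨ p = t₁ ∨ p = r₁ ∨ ∃ (e : ℕ) (b : Bool), e ≤ 1 ∧ p = c₁ e b

/-- The vertices of the assignment gadgets of the second curve: `r₂` and the `c₂ e b`.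
[cite: BringmannFOCS2014, §3.1] -/
def IsGadget₂ (q : ℤ × ℤ) : Prop :=
  q = r₂ ∨ ∃ (e : ℕ) (b : Bool), e ≤ 1 ∧ q = c₂ e b

section table

/-- Every vertex of the first curve is close to `s₂`. [cite: BringmannFOCS2014, Lemma 3.3] -/
theorem close_s₂_of_isQ₁ {p : ℤ × ℤ} (h : IsQ₁ p) : Close 3000 p s₂ := by
  rw [close_iff_sqDist]
  rcases h with rfl | rfl | rfl | ⟨e, b, he, rfl⟩
  · simp [sqDist, s₁, s₂]
  · simp [sqDist, t₁, s₂]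
  · simp [sqDist, r₁, s₂]
  · interval_cases e <;> cases b <;> simp [sqDist, c₁, s₂]

/-- Every vertex of the first curve is close to `t₂`. [cite: BringmannFOCS2014, Lemma 3.3] -/
theorem close_t₂_of_isQ₁ {p : ℤ × ℤ} (h : IsQ₁ p) : Close 3000 p t₂ := by
  rw [close_iff_sqDist]
  rcases h with rfl | rfl | rfl | ⟨e, b, he, rfl⟩
  · simp [sqDist, s₁, t₂]
  · simp [sqDist, t₁, t₂]
  · simp [sqDist, r₁, t₂]
  · interval_cases e <;> cases b <;> simp [sqDist, c₁, t₂]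

/-- `s₁` is close to `s₂`. [cite: BringmannFOCS2014, Lemma 3.3] -/
theorem close_s₁_s₂ : Close 3000 s₁ s₂ := by rw [close_iff_sqDist]; simp [sqDist, s₁, s₂]
/-- `s₁` is close to `s₂' = s₂*`. [cite: BringmannFOCS2014, Lemma 3.3] -/
theorem close_s₁_s₂' : Close 3000 s₁ s₂' := by rw [close_iff_sqDist]; simp [sqDist, s₁, s₂']
/-- `s₁` is close to `t₂`. [cite: BringmannFOCS2014, Lemma 3.3] -/
theorem close_s₁_t₂ : Close 3000 s₁ t₂ := by rw [close_iff_sqDist]; simp [sqDist, s₁, t₂]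
/-- `s₁` is close to every gadget vertex of the second curve. [cite: BringmannFOCS2014, Lemma 3.3] -/
theorem close_s₁_of_isGadget₂ {q : ℤ × ℤ} (h : IsGadget₂ q) : Close 3000 s₁ q := by
  rw [close_iff_sqDist]
  rcases h with rfl | ⟨e, b, he, rfl⟩
  · simp [sqDist, s₁, r₂]
  · interval_cases e <;> cases b <;> simp [sqDist, c₂, s₁]
/-- `s₁` is *not* close to `t₂' = t₂*`. [cite: BringmannFOCS2014, Lemma 3.3] -/
theorem not_close_s₁_t₂' : ¬ Close 3000 s₁ t₂' := by rw [close_iff_sqDist]; simp [sqDist, s₁, t₂']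

/-- `t₁` is close to every gadget vertex of the second curve. [cite: BringmannFOCS2014, Lemma 3.3] -/
theorem close_t₁_of_isGadget₂ {q : ℤ × ℤ} (h : IsGadget₂ q) : Close 3000 t₁ q := by
  rw [close_iff_sqDist]
  rcases h with rfl | ⟨e, b, he, rfl⟩
  · simp [sqDist, t₁, r₂]
  · interval_cases e <;> cases b <;> simp [sqDist, c₂, t₁]
/-- `t₁` is close to `t₂' = t₂*`. [cite: BringmannFOCS2014, Lemma 3.3] -/
theorem close_t₁_t₂' : Close 3000 t₁ t₂' := by rw [close_iff_sqDist]; simp [sqDist, t₁, t₂']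
/-- `t₁` is close to `t₂`. [cite: BringmannFOCS2014, Lemma 3.3] -/
theorem close_t₁_t₂ : Close 3000 t₁ t₂ := by rw [close_iff_sqDist]; simp [sqDist, t₁, t₂]

/-- `r₁` is close to `r₂` (distance exactly `τ`). [cite: BringmannFOCS2014, Lemma 3.3] -/
theorem close_r₁_r₂ : Close 3000 r₁ r₂ := by rw [close_iff_sqDist]; simp [sqDist, r₁, r₂]
/-- `r₁` is not close to `s₂'`. [cite: BringmannFOCS2014, Lemma 3.3] -/
theorem not_close_r₁_s₂' : ¬ Close 3000 r₁ s₂' := by rw [close_iff_sqDist]; simp [sqDist, r₁, s₂']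
/-- `r₁` is not close to `t₂'`. [cite: BringmannFOCS2014, Lemma 3.3] -/
theorem not_close_r₁_t₂' : ¬ Close 3000 r₁ t₂' := by rw [close_iff_sqDist]; simp [sqDist, r₁, t₂']
/-- `r₁` is not close to any clause gadget of the second curve. [cite: BringmannFOCS2014, Lemma 3.3] -/
theorem not_close_r₁_c₂ {e : ℕ} (he : e ≤ 1) (b : Bool) : ¬ Close 3000 r₁ (c₂ e b) := by
  rw [close_iff_sqDist]
  interval_cases e <;> cases b <;> simp [sqDist, c₂, r₁]
/-- A gadget vertex of the second curve close to `r₁` is `r₂`. [cite: BringmannFOCS2014, Lemma 3.3] -/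
theorem eq_r₂_of_close_r₁ {q : ℤ × ℤ} (h : IsGadget₂ q) (hc : Close 3000 r₁ q) : q = r₂ := by
  rcases h with rfl | ⟨e, b, he, rfl⟩
  · rfl
  · exact absurd hc (not_close_r₁_c₂ he b)

/-- No clause gadget of the first curve is close to `r₂`. [cite: BringmannFOCS2014, Lemma 3.3] -/
theorem not_close_c₁_r₂ {e : ℕ} (he : e ≤ 1) (b : Bool) : ¬ Close 3000 (c₁ e b) r₂ := by
  rw [close_iff_sqDist]
  interval_cases e <;> cases b <;> simp [sqDist, c₁, r₂]

/-- **Lemma 3.1**: clause gadgets of the same parity are close iff one of the two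
half-assignments satisfies the clause. [cite: BringmannFOCS2014, Lemma 3.1] -/
theorem close_c₁_c₂_iff {e : ℕ} (he : e ≤ 1) (x y : Bool) :
    Close 3000 (c₁ e x) (c₂ e y) ↔ (x || y) = true := by
  rw [close_iff_sqDist]
  interval_cases e <;> cases x <;> cases y <;> simp [sqDist, c₁, c₂]

/-- **Lemma 3.1**: clause gadgets of different parity are not close.
[cite: BringmannFOCS2014, Lemma 3.1] -/
theorem not_close_c₁_c₂_of_ne {e e' : ℕ} (he : e ≤ 1) (he' : e' ≤ 1) (hne : e ≠ e') (x y : Bool) :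
    ¬ Close 3000 (c₁ e x) (c₂ e' y) := by
  rw [close_iff_sqDist]
  interval_cases e <;> interval_cases e' <;> first | exact absurd rfl hne |
    (cases x <;> cases y <;> simp [sqDist, c₁, c₂])

/-- The only vertex of the first curve close to `s₂' = s₂*` is `s₁`.
[cite: BringmannFOCS2014, Lemma 3.3] -/
theorem eq_s₁_of_close_s₂' {p : ℤ × ℤ} (h : IsQ₁ p) (hc : Close 3000 p s₂') : p = s₁ := by
  rw [close_iff_sqDist] at hc
  rcases h with rfl | rfl | rfl | ⟨e, b, he, rfl⟩
  · rfl
  · simp [sqDist, t₁, s₂'] at hc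
  · simp [sqDist, r₁, s₂'] at hc
  · interval_cases e <;> cases b <;> simp [sqDist, c₁, s₂'] at hc

end table

/-! ### Half-assignments as numbers -/

/-- `sat₁ n₁ A C`: the assignment of the first `n₁` variables given by the low `n₁` bits of `A`
already satisfies clause `C`, i.e. `C` has a literal on a variable `v < n₁` whose polarity is bit
`v` of `A` (Bringmann's `sat(a₁, C)` for a partial assignment `a₁` of `V₁`).
[cite: BringmannFOCS2014, §2 (Satisfiability)] -/
def sat₁ (n₁ A : ℕ) (C : Clause ℕ) : Bool :=
  C.any fun l => decide (l.1 < n₁) && (A.testBit l.1 == l.2)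

/-- `sat₂ n₁ B C`: the assignment of the variables `v ≥ n₁` given by the bits of `B` (bit `v - n₁`)
already satisfies clause `C` (Bringmann's `sat(a₂, C)` for a partial assignment of `V₂`).
[cite: BringmannFOCS2014, §2 (Satisfiability)] -/
def sat₂ (n₁ B : ℕ) (C : Clause ℕ) : Bool :=
  C.any fun l => decide (n₁ ≤ l.1) && (B.testBit (l.1 - n₁) == l.2)

/-- The total assignment `(a₁, a₂)` determined by two half-assignments `A`, `B`. [folklore] -/
def assignment (n₁ A B : ℕ) : ℕ → Bool := fun v =>
  if v < n₁ then A.testBit v else B.testBit (v - n₁)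

/-- A clause is satisfied by `(a₁, a₂)` iff `sat(a₁, C) ∨ sat(a₂, C)` (Bringmann 2014, §2).
[cite: BringmannFOCS2014, §2 (Satisfiability)] -/
theorem eval_assignment (n₁ A B : ℕ) (C : Clause ℕ) :
    C.eval (assignment n₁ A B) = (sat₁ n₁ A C || sat₂ n₁ B C) := by
  rw [Bool.eq_iff_iff]
  simp only [Clause.eval, sat₁, sat₂, List.any_eq_true, Bool.or_eq_true, Bool.and_eq_true,
    decide_eq_true_eq]
  constructor
  · rintro ⟨l, hl, h⟩
    by_cases hv : l.1 < n₁
    · exact Or.inl ⟨l, hl, hv, by simpa [Literal.eval, assignment, hv] using h⟩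
    · exact Or.inr ⟨l, hl, not_lt.1 hv, by simpa [Literal.eval, assignment, hv] using h⟩
  · rintro (⟨l, hl, hv, h⟩ | ⟨l, hl, hv, h⟩)
    · exact ⟨l, hl, by simpa [Literal.eval, assignment, hv] using h⟩
    · exact ⟨l, hl, by simpa [Literal.eval, assignment, not_lt.2 hv] using h⟩

/-- The number whose `n` low bits are `f 0, …, f (n - 1)`. [folklore] -/
def ofBits : ℕ → (ℕ → Bool) → ℕ
  | 0, _ => 0
  | n + 1, f => Nat.bit (f 0) (ofBits n fun i => f (i + 1))

/-- The bits of `ofBits n f` are the values of `f`. [folklore] -/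
theorem testBit_ofBits : ∀ (n : ℕ) (f : ℕ → Bool) (i : ℕ), i < n → (ofBits n f).testBit i = f i
  | 0, _, _, h => absurd h (Nat.not_lt_zero _)
  | _ + 1, _, 0, _ => by rw [ofBits, Nat.testBit_bit_zero]
  | n + 1, f, i + 1, h => by
    rw [ofBits, Nat.testBit_bit_succ, testBit_ofBits n _ i (by omega)]

/-- `ofBits n f < 2 ^ n`. [folklore] -/
theorem ofBits_lt : ∀ (n : ℕ) (f : ℕ → Bool), ofBits n f < 2 ^ n
  | 0, _ => Nat.one_pos
  | n + 1, f => by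
    rw [ofBits, Nat.bit_val, pow_succ]
    have := ofBits_lt n fun i => f (i + 1)
    cases f 0 <;> simp <;> omega

/-- Clause values depend only on the variables of the clause. [folklore] -/
theorem clause_eval_congr {σ σ' : ℕ → Bool} {C : Clause ℕ} (h : ∀ l ∈ C, σ l.1 = σ' l.1) :
    C.eval σ = C.eval σ' := by
  unfold Clause.eval
  induction C with
  | nil => rfl
  | cons l C ih =>
    simp only [List.any_cons]
    rw [ih fun l' hl' => h l' (List.mem_cons_of_mem _ hl')]
    simp [Literal.eval, h l (by simp)]

/-- **Split and list.** A CNF on at most `n₁ + n₂` variables is satisfiable iff some pair of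
half-assignments `A < 2^{n₁}` (variables `< n₁`) and `B < 2^{n₂}` (variables `≥ n₁`) satisfies
every clause in the sense `sat(a₁, C) ∨ sat(a₂, C)` (Bringmann 2014, §2; R. Williams 2005).
[cite: BringmannFOCS2014, §2 (Satisfiability)] -/
theorem satisfiable_iff_exists {φ : CNF ℕ} {n₁ n₂ : ℕ} (hn : φ.numVars ≤ n₁ + n₂) :
    φ.Satisfiable ↔ ∃ A B : ℕ, A < 2 ^ n₁ ∧ B < 2 ^ n₂ ∧
      ∀ C ∈ φ, (sat₁ n₁ A C || sat₂ n₁ B C) = true := by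
  constructor
  · rintro ⟨σ, hσ⟩
    refine ⟨ofBits n₁ σ, ofBits n₂ fun i => σ (n₁ + i), ofBits_lt _ _, ofBits_lt _ _, fun C hC => ?_⟩
    rw [← eval_assignment, ← (CNF.eval_eq_true_iff φ σ).1 hσ C hC]
    refine clause_eval_congr fun l hl => ?_
    have hv : l.1 < n₁ + n₂ := (CNF.lt_numVars_of_mem hC hl).trans_le hn
    unfold assignment
    split_ifs with h
    · exact testBit_ofBits _ _ _ h
    · rw [testBit_ofBits _ _ _ (by omega)]; congr 1; omega
  · rintro ⟨A, B, -, -, h⟩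
    exact ⟨assignment n₁ A B, (CNF.eval_eq_true_iff φ _).2 fun C hC => by
      rw [eval_assignment]; exact h C hC⟩

/-! ### The curves (Bringmann 2014, §3.1) -/

/-- The clause gadgets of the half-assignment `A` of the first half, in clause order:
`CG(a₁, i) = c₁ (i % 2) (sat(a₁, Cᵢ))`, `i = 0, …, M - 1`. [cite: BringmannFOCS2014, §3.1] -/
def clauseGadgets₁ (φ : CNF ℕ) (n₁ A : ℕ) : List (ℤ × ℤ) :=
  (List.range φ.length).map fun i => c₁ (i % 2) (sat₁ n₁ A (φ.getD i []))

/-- The clause gadgets of the half-assignment `B` of the second half: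
`CG(a₂, i) = c₂ (i % 2) (sat(a₂, Cᵢ))`. [cite: BringmannFOCS2014, §3.1] -/
def clauseGadgets₂ (φ : CNF ℕ) (n₁ B : ℕ) : List (ℤ × ℤ) :=
  (List.range φ.length).map fun i => c₂ (i % 2) (sat₂ n₁ B (φ.getD i []))

/-- The assignment gadget `AG(a₁) = r₁ ∘ CG(a₁, 0) ∘ ⋯ ∘ CG(a₁, M - 1)`.
[cite: BringmannFOCS2014, §3.1] -/
def gadget₁ (φ : CNF ℕ) (n₁ A : ℕ) : List (ℤ × ℤ) :=
  r₁ :: clauseGadgets₁ φ n₁ A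

/-- The assignment gadget `AG(a₂) = r₂ ∘ CG(a₂, 0) ∘ ⋯ ∘ CG(a₂, M - 1)`.
[cite: BringmannFOCS2014, §3.1] -/
def gadget₂ (φ : CNF ℕ) (n₁ B : ℕ) : List (ℤ × ℤ) :=
  r₂ :: clauseGadgets₂ φ n₁ B

/-- The block `s₁ ∘ AG(a₁) ∘ t₁` of the first curve. [cite: BringmannFOCS2014, §3.1] -/
def block₁ (φ : CNF ℕ) (n₁ A : ℕ) : List (ℤ × ℤ) :=
  s₁ :: (gadget₁ φ n₁ A ++ [t₁])

/-- **The first curve** `P₁ = ○_{a₁ ∈ A₁} (s₁ ∘ AG(a₁) ∘ t₁)`, the half-assignments `a₁` of the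
first `n₁` variables being enumerated as `A = 0, …, 2^{n₁} - 1`. [cite: BringmannFOCS2014, §3.1] -/
def curveP₁ (φ : CNF ℕ) (n₁ : ℕ) : List (ℤ × ℤ) :=
  ((List.range (2 ^ n₁)).map (block₁ φ n₁)).flatten

/-- The assignment gadgets `○_{a₂ ∈ A₂} AG(a₂)` of the second curve, `B = 0, …, 2^{n₂} - 1`.
[cite: BringmannFOCS2014, §3.1] -/
def gadgets₂ (φ : CNF ℕ) (n₁ n₂ : ℕ) : List (ℤ × ℤ) :=
  ((List.range (2 ^ n₂)).map (gadget₂ φ n₁)).flatten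

/-- **The second curve** `P₂ = s₂ ∘ s₂* ∘ (○_{a₂ ∈ A₂} AG(a₂)) ∘ t₂* ∘ t₂`.
[cite: BringmannFOCS2014, §3.1] -/
def curveP₂ (φ : CNF ℕ) (n₁ n₂ : ℕ) : List (ℤ × ℤ) :=
  s₂ :: s₂' :: (gadgets₂ φ n₁ n₂ ++ [t₂', t₂])

section curves

variable {φ : CNF ℕ} {n₁ n₂ : ℕ}

/-- Length of the clause gadget list. [folklore] -/
@[simp] theorem length_clauseGadgets₁ (A : ℕ) : (clauseGadgets₁ φ n₁ A).length = φ.length := by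
  simp [clauseGadgets₁]

/-- Length of the clause gadget list. [folklore] -/
@[simp] theorem length_clauseGadgets₂ (B : ℕ) : (clauseGadgets₂ φ n₁ B).length = φ.length := by
  simp [clauseGadgets₂]

/-- The vertices of a block are in `Q₁`. [folklore] -/
theorem isQ₁_of_mem_block₁ {A : ℕ} {p : ℤ × ℤ} (h : p ∈ block₁ φ n₁ A) : IsQ₁ p := by
  simp only [block₁, gadget₁, clauseGadgets₁, List.mem_cons, List.mem_append, List.mem_map,
    List.mem_range, List.not_mem_nil, or_false] at h
  rcases h with rfl | (rfl | ⟨i, -, rfl⟩) | rfl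
  · exact Or.inl rfl
  · exact Or.inr (Or.inr (Or.inl rfl))
  · exact Or.inr (Or.inr (Or.inr ⟨i % 2, _, Nat.lt_succ_iff.1 (Nat.mod_lt i two_pos), rfl⟩))
  · exact Or.inr (Or.inl rfl)

/-- The vertices of the first curve are in `Q₁`. [folklore] -/
theorem isQ₁_of_mem_curveP₁ {p : ℤ × ℤ} (h : p ∈ curveP₁ φ n₁) : IsQ₁ p := by
  simp only [curveP₁, List.mem_flatten, List.mem_map, List.mem_range] at h
  obtain ⟨b, ⟨A, -, rfl⟩, hp⟩ := h
  exact isQ₁_of_mem_block₁ hp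

/-- The vertices of an assignment gadget of the second curve. [folklore] -/
theorem isGadget₂_of_mem_gadget₂ {B : ℕ} {q : ℤ × ℤ} (h : q ∈ gadget₂ φ n₁ B) : IsGadget₂ q := by
  simp only [gadget₂, clauseGadgets₂, List.mem_cons, List.mem_map, List.mem_range] at h
  rcases h with rfl | ⟨i, -, rfl⟩
  · exact Or.inl rfl
  · exact Or.inr ⟨i % 2, _, Nat.lt_succ_iff.1 (Nat.mod_lt i two_pos), rfl⟩

/-- The vertices of the gadget part of the second curve. [folklore] -/
theorem isGadget₂_of_mem_gadgets₂ {q : ℤ × ℤ} (h : q ∈ gadgets₂ φ n₁ n₂) : IsGadget₂ q := by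
  simp only [gadgets₂, List.mem_flatten, List.mem_map, List.mem_range] at h
  obtain ⟨g, ⟨B, -, rfl⟩, hq⟩ := h
  exact isGadget₂_of_mem_gadget₂ hq

/-- `s₁` does not occur in `AG(a₁) ∘ t₁`. [folklore] -/
theorem s₁_not_mem (A : ℕ) : s₁ ∉ gadget₁ φ n₁ A ++ [t₁] := by
  simp only [gadget₁, clauseGadgets₁, List.mem_append, List.mem_cons, List.mem_map, List.mem_range,
    not_or, not_exists, not_and]
  refine ⟨⟨by decide, fun i _ h => ?_⟩, by decide⟩
  have := congrArg Prod.snd h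
  simp only [c₁, s₁] at this
  split at this <;> omega

/-- `r₂` does not occur among the clause gadgets. [folklore] -/
theorem r₂_not_mem (B : ℕ) : r₂ ∉ clauseGadgets₂ φ n₁ B := by
  simp only [clauseGadgets₂, List.mem_map, List.mem_range, not_exists, not_and]
  intro i _ h
  have := congrArg Prod.snd h
  simp only [c₂, r₂] at this
  split at this <;> omega

/-- The first curve starts with the block of `A = 0`; in particular it is nonempty. [folklore] -/
theorem curveP₁_eq_cons : ∃ rest, curveP₁ φ n₁ = block₁ φ n₁ 0 ++ rest := by
  obtain ⟨m, hm⟩ : ∃ m, 2 ^ n₁ = m + 1 := ⟨2 ^ n₁ - 1, (Nat.succ_pred_eq_of_pos (Nat.two_pow_pos n₁)).symm⟩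
  refine ⟨(((List.range m).map Nat.succ).map (block₁ φ n₁)).flatten, ?_⟩
  rw [curveP₁, hm, List.range_succ_eq_map]
  simp

/-- The first curve is nonempty. [folklore] -/
theorem curveP₁_ne_nil : curveP₁ φ n₁ ≠ [] := by
  obtain ⟨rest, h⟩ := curveP₁_eq_cons (φ := φ) (n₁ := n₁)
  rw [h]; simp [block₁]

/-- The second curve is nonempty. [folklore] -/
theorem curveP₂_ne_nil : curveP₂ φ n₁ n₂ ≠ [] := List.cons_ne_nil _ _

end curves

/-! ### Locating blocks in a concatenation -/

/-- In a concatenation of blocks each starting with a marker `x` that occurs nowhere else in its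
block, every occurrence of `x` is the start of a block. [folklore] -/
theorem exists_of_flatten_eq_append_cons {α : Type*} {x : α} {blocks : List (List α)}
    (hb : ∀ b ∈ blocks, ∃ t, b = x :: t ∧ x ∉ t) {pre tail : List α}
    (h : blocks.flatten = pre ++ x :: tail) :
    ∃ (B₁ : List (List α)) (b : List α) (B₂ : List (List α)),
      blocks = B₁ ++ b :: B₂ ∧ pre = B₁.flatten ∧ x :: tail = b ++ B₂.flatten := by
  induction blocks generalizing pre with
  | nil => cases pre <;> simp at h
  | cons b bs ih =>
    obtain ⟨t, rfl, hxt⟩ := hb b (by simp)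
    have hb' : ∀ b' ∈ bs, ∃ t, b' = x :: t ∧ x ∉ t := fun b' hb'' => hb b' (by simp [hb''])
    rw [List.flatten_cons] at h
    cases pre with
    | nil =>
      refine ⟨[], x :: t, bs, rfl, rfl, ?_⟩
      simpa using h.symm
    | cons y pre =>
      simp only [List.cons_append, List.cons.injEq] at h
      obtain ⟨rfl, h⟩ := h
      rcases List.append_eq_append_iff.1 h with ⟨a', rfl, ha'⟩ | ⟨c', rfl, hc'⟩
      · obtain ⟨B₁, b', B₂, rfl, rfl, hb''⟩ := ih hb' ha'
        exact ⟨(x :: t) :: B₁, b', B₂, rfl, by simp, hb''⟩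
      · cases c' with
        | nil =>
          simp only [List.nil_append] at hc'
          obtain ⟨B₁, b', B₂, rfl, hnil, hb''⟩ := ih hb' (pre := []) (by simpa using hc'.symm)
          refine ⟨(x :: (pre ++ [])) :: B₁, b', B₂, rfl, ?_, hb''⟩
          simp [← hnil]
        | cons z c'' =>
          simp only [List.cons_append, List.cons.injEq] at hc'
          obtain ⟨rfl, -⟩ := hc'
          exact absurd (by simp) hxt

/-- Splitting a concatenation of blocks around block `i`. [folklore] -/
theorem exists_split_flatten_map {α : Type*} (f : ℕ → List α) {n i : ℕ} (hi : i < n) :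
    ∃ pre post : List α, ((List.range n).map f).flatten = pre ++ f i ++ post ∧
      (∀ a ∈ pre, ∃ j < n, a ∈ f j) ∧ (∀ a ∈ post, ∃ j < n, a ∈ f j) := by
  obtain ⟨k, rfl⟩ := Nat.exists_eq_add_of_lt hi
  refine ⟨((List.range i).map f).flatten, ((List.range k).map fun j => f (i + 1 + j)).flatten,
    ?_, ?_, ?_⟩
  · rw [show i + k + 1 = i + (1 + k) by omega, List.range_add, List.range_add]
    simp [List.flatten_append, Function.comp_def, Nat.add_assoc]
  · intro a ha
    simp only [List.mem_flatten, List.mem_map, List.mem_range] at ha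
    obtain ⟨l, ⟨j, hj, rfl⟩, ha⟩ := ha
    exact ⟨j, by omega, ha⟩
  · intro a ha
    simp only [List.mem_flatten, List.mem_map, List.mem_range] at ha
    obtain ⟨l, ⟨j, hj, rfl⟩, ha⟩ := ha
    exact ⟨i + 1 + j, by omega, ha⟩

/-! ### Correctness of the construction (Bringmann 2014, Lemmas 3.2, 3.4, 3.5) -/

section correctness

variable {φ : CNF ℕ} {n₁ n₂ : ℕ}

/-- **Lemma 3.2 (unsatisfied case, contrapositive).** A traversal of width `τ` of
`(AG(a₁) ∘ π₁, AG(a₂) ∘ π₂)` walks the two assignment gadgets in lockstep, so every clause is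
satisfied by `a₁` or by `a₂`. [cite: BringmannFOCS2014, Lemma 3.2] -/
theorem forall_sat_of_widthLE_gadgets {A B : ℕ} {π₁ π₂ : List (ℤ × ℤ)}
    (h : WidthLE 3000 (gadget₁ φ n₁ A ++ π₁) (gadget₂ φ n₁ B ++ π₂)) :
    ∀ i < φ.length, (sat₁ n₁ A (φ.getD i []) || sat₂ n₁ B (φ.getD i [])) = true := by
  have hlen : (gadget₁ φ n₁ A).length = (gadget₂ φ n₁ B).length := by simp [gadget₁, gadget₂]
  have two : ∀ i : ℕ, i % 2 ≤ 1 := fun i => Nat.lt_succ_iff.1 (Nat.mod_lt i two_pos)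
  have key := forall_close_of_widthLE_append hlen ?_ h
  · intro i hi
    have := key (i + 1) (by simpa [gadget₁] using hi)
    simp only [gadget₁, gadget₂, List.getElem_cons_succ, clauseGadgets₁, clauseGadgets₂,
      List.getElem_map, List.getElem_range] at this
    exact (close_c₁_c₂_iff (two i) _ _).1 this
  · intro i hi
    cases i with
    | zero =>
      simp only [gadget₁, gadget₂, List.getElem_cons_succ, List.getElem_cons_zero, clauseGadgets₁,
        clauseGadgets₂, List.getElem_map, List.getElem_range]
      exact ⟨not_close_c₁_r₂ (two 0) _, not_close_r₁_c₂ (two 0) _⟩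
    | succ j =>
      simp only [gadget₁, gadget₂, List.getElem_cons_succ, clauseGadgets₁, clauseGadgets₂,
        List.getElem_map, List.getElem_range]
      have h2 : (j + 1) % 2 ≠ j % 2 := by omega
      exact ⟨not_close_c₁_c₂_of_ne (two _) (two _) h2 _ _,
        not_close_c₁_c₂_of_ne (two _) (two _) (Ne.symm h2) _ _⟩

/-- Two half-assignments satisfying every clause give a satisfying assignment. [folklore] -/
theorem satisfiable_of_forall_sat {A B : ℕ}
    (h : ∀ i < φ.length, (sat₁ n₁ A (φ.getD i []) || sat₂ n₁ B (φ.getD i [])) = true) :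
    φ.Satisfiable := by
  refine ⟨assignment n₁ A B, (CNF.eval_eq_true_iff φ _).2 fun C hC => ?_⟩
  obtain ⟨i, hi, rfl⟩ := List.getElem_of_mem hC
  rw [eval_assignment]
  have := h i hi
  rwa [List.getD_eq_getElem?_getD, List.getElem?_eq_getElem hi, Option.getD_some] at this

/-- **Lemma 3.4.** If `d_dF(P₁, P₂) ≤ τ` then `φ` is satisfiable: when the traversal stands on
`s₂*` it stands on a copy of `s₁` in `P₁` (the only vertex of `P₁` close to `s₂*`), say the one
opening the block of `a₁`; when it then first stands on `r₁` it stands on the `r₂` of some `AG(a₂)`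
(`s₂` is passed, `t₂*` is out of reach from `s₁` and `r₁`, and `r₂` is the only other vertex close
to `r₁`); from there Lemma 3.2 applies. [cite: BringmannFOCS2014, Lemma 3.4] -/
theorem satisfiable_of_widthLE_curves (h : WidthLE 3000 (curveP₁ φ n₁) (curveP₂ φ n₁ n₂)) :
    φ.Satisfiable := by
  -- the moment the traversal stands on `s₂'`
  have h0 : WidthLE 3000 (curveP₁ φ n₁) ([s₂] ++ s₂' :: (gadgets₂ φ n₁ n₂ ++ [t₂', t₂])) := by
    simpa [curveP₂] using h
  obtain ⟨P₁, P₂, hP, hW⟩ := exists_suffix_of_widthLE_append_cons h0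
  obtain ⟨p, P₂, rfl⟩ : ∃ (p : ℤ × ℤ) (P₂' : List (ℤ × ℤ)), P₂ = p :: P₂' := by
    cases P₂ with
    | nil => exact absurd hW (not_widthLE_nil_cons _ _)
    | cons p P₂' => exact ⟨p, P₂', rfl⟩
  have hp : p = s₁ :=
    eq_s₁_of_close_s₂' (isQ₁_of_mem_curveP₁ (by rw [hP]; simp)) (widthLE_cons_cons_iff.1 hW).1
  subst hp
  -- `s₁` opens the block of some half-assignment `A`
  obtain ⟨B₁, b, B₂, hblocks, -, hb⟩ := exists_of_flatten_eq_append_cons (x := s₁)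
    (blocks := (List.range (2 ^ n₁)).map (block₁ φ n₁))
    (fun b hb => by
      obtain ⟨A, -, rfl⟩ := List.mem_map.1 hb
      exact ⟨_, rfl, s₁_not_mem A⟩) hP
  obtain ⟨A, -, rfl⟩ : ∃ A, A < 2 ^ n₁ ∧ block₁ φ n₁ A = b := by
    have : b ∈ (List.range (2 ^ n₁)).map (block₁ φ n₁) := by rw [hblocks]; simp
    simpa [List.mem_map, List.mem_range] using this
  have hP₂ : P₂ = gadget₁ φ n₁ A ++ (t₁ :: B₂.flatten) := by
    simpa [block₁] using hb
  subst hP₂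
  -- how a first stand on `r₁` against a gadget vertex `g` finishes the proof
  have finish : ∀ (pre tail : List (ℤ × ℤ)) (g : ℤ × ℤ), gadgets₂ φ n₁ n₂ = pre ++ g :: tail →
      Close 3000 r₁ g →
      WidthLE 3000 (gadget₁ φ n₁ A ++ (t₁ :: B₂.flatten)) ((g :: tail) ++ [t₂', t₂]) →
      φ.Satisfiable := by
    intro pre tail g hG hcg hWg
    have hg : g = r₂ := eq_r₂_of_close_r₁ (isGadget₂_of_mem_gadgets₂ (by rw [hG]; simp)) hcg
    subst hg
    obtain ⟨G₁, g', G₂, hGs, -, hg'⟩ := exists_of_flatten_eq_append_cons (x := r₂)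
      (blocks := (List.range (2 ^ n₂)).map (gadget₂ φ n₁))
      (fun b hb => by
        obtain ⟨B, -, rfl⟩ := List.mem_map.1 hb
        exact ⟨_, rfl, r₂_not_mem B⟩) hG
    obtain ⟨B, -, rfl⟩ : ∃ B, B < 2 ^ n₂ ∧ gadget₂ φ n₁ B = g' := by
      have : g' ∈ (List.range (2 ^ n₂)).map (gadget₂ φ n₁) := by rw [hGs]; simp
      simpa [List.mem_map, List.mem_range] using this
    rw [hg', List.append_assoc] at hWg
    exact satisfiable_of_forall_sat (forall_sat_of_widthLE_gadgets hWg)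
  -- leaving the row of `s₁`
  obtain ⟨qs₁, q, qs₂, hQ, hqs₁, hq, hrow⟩ := exists_split_of_widthLE_cons hW
  cases qs₁ with
  | nil =>
    simp only [List.nil_append, List.cons.injEq] at hQ
    obtain ⟨rfl, rfl⟩ := hQ
    rcases hrow with hW' | hW'
    · exact absurd (widthLE_cons_cons_iff.1 hW').1 not_close_r₁_s₂'
    · cases hG : gadgets₂ φ n₁ n₂ with
      | nil =>
        rw [hG] at hW'
        exact absurd (widthLE_cons_cons_iff.1 hW').1 not_close_r₁_t₂'
      | cons g tail =>
        rw [hG] at hW'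
        exact finish [] tail g (by simp [hG]) (widthLE_cons_cons_iff.1 hW').1 hW'
  | cons q₀ qs₁ =>
    simp only [List.cons_append, List.cons.injEq] at hQ
    obtain ⟨rfl, hQ⟩ := hQ
    rcases List.append_eq_append_iff.1 hQ with ⟨a', rfl, ha'⟩ | ⟨cc, hcc, hq'⟩
    · -- `q` would be `t₂'` or come after it
      cases a' with
      | nil =>
        simp only [List.nil_append, List.cons.injEq] at ha'
        obtain ⟨rfl, -⟩ := ha'
        exact absurd hq not_close_s₁_t₂'
      | cons a a'' =>
        simp only [List.cons_append, List.cons.injEq] at ha'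
        obtain ⟨rfl, -⟩ := ha'
        exact absurd (hqs₁ t₂' (by simp)) not_close_s₁_t₂'
    · cases cc with
      | nil =>
        simp only [List.nil_append, List.cons.injEq] at hq'
        obtain ⟨rfl, -⟩ := hq'
        exact absurd hq not_close_s₁_t₂'
      | cons g cc =>
        simp only [List.cons_append, List.cons.injEq] at hq'
        obtain ⟨rfl, rfl⟩ := hq'
        rcases hrow with hW' | hW'
        · exact finish qs₁ cc q hcc (widthLE_cons_cons_iff.1 hW').1 hW'
        · cases cc with
          | nil => exact absurd (widthLE_cons_cons_iff.1 hW').1 not_close_r₁_t₂'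
          | cons g' ccc =>
            exact finish (qs₁ ++ [q]) ccc g' (by rw [hcc]; simp)
              (widthLE_cons_cons_iff.1 hW').1 hW'

/-- **Lemma 3.5.** If the half-assignments `(a₁, a₂) = (A, B)` satisfy every clause then
`d_dF(P₁, P₂) ≤ τ`: stand on `s₂` and walk `P₁` to the block of `a₁`; stand on its `s₁` and walk
`P₂` to `AG(a₂)`; step to `(r₁, r₂)` and walk the two gadgets in lockstep (Lemma 3.1); stand on
`t₁` and walk `P₂` to its end `t₂`; stand on `t₂` and finish `P₁`. [cite: BringmannFOCS2014, Lemma 3.5] -/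
theorem widthLE_curves_of_sat {A B : ℕ} (hA : A < 2 ^ n₁) (hB : B < 2 ^ n₂)
    (hsat : ∀ i < φ.length, (sat₁ n₁ A (φ.getD i []) || sat₂ n₁ B (φ.getD i [])) = true) :
    WidthLE 3000 (curveP₁ φ n₁) (curveP₂ φ n₁ n₂) := by
  obtain ⟨pre₁, post₁, h₁, hpre₁, hpost₁⟩ := exists_split_flatten_map (block₁ φ n₁) hA
  obtain ⟨pre₂, post₂, h₂, hpre₂, hpost₂⟩ := exists_split_flatten_map (gadget₂ φ n₁) hB
  have hQ₁ : ∀ p ∈ pre₁ ++ post₁, IsQ₁ p := by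
    intro p hp
    rcases List.mem_append.1 hp with hp | hp
    · obtain ⟨j, -, hj⟩ := hpre₁ p hp; exact isQ₁_of_mem_block₁ hj
    · obtain ⟨j, -, hj⟩ := hpost₁ p hp; exact isQ₁_of_mem_block₁ hj
  have hG₂ : ∀ q ∈ pre₂ ++ post₂, IsGadget₂ q := by
    intro q hq
    rcases List.mem_append.1 hq with hq | hq
    · obtain ⟨j, -, hj⟩ := hpre₂ q hq; exact isGadget₂_of_mem_gadget₂ hj
    · obtain ⟨j, -, hj⟩ := hpost₂ q hq; exact isGadget₂_of_mem_gadget₂ hj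
  have two : ∀ i : ℕ, i % 2 ≤ 1 := fun i => Nat.lt_succ_iff.1 (Nat.mod_lt i two_pos)
  -- (5) stand on `t₁`, walk `P₂` to `t₂`, stand on `t₂`, finish `P₁`
  have step5 : WidthLE 3000 (t₁ :: post₁) ((post₂ ++ [t₂']) ++ [t₂]) := by
    refine widthLE_cons_append (fun q hq => ?_) (widthLE_singleton_right (List.cons_ne_nil _ _)
      fun p hp => close_t₂_of_isQ₁ ?_)
    · rcases List.mem_append.1 hq with hq | hq
      · exact close_t₁_of_isGadget₂ (hG₂ q (by simp [hq]))
      · rw [List.mem_singleton.1 hq]; exact close_t₁_t₂'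
    · rcases List.mem_cons.1 hp with rfl | hp
      · exact Or.inr (Or.inl rfl)
      · exact hQ₁ p (by simp [hp])
  -- (4) the two assignment gadgets in lockstep
  have step4 : WidthLE 3000 (gadget₁ φ n₁ A ++ (t₁ :: post₁))
      (gadget₂ φ n₁ B ++ (post₂ ++ [t₂', t₂])) := by
    refine widthLE_append_append (List.Forall₂.cons close_r₁_r₂ ?_) (by simpa using step5)
    simp only [clauseGadgets₁, clauseGadgets₂, List.forall₂_map_left_iff,
      List.forall₂_map_right_iff, List.forall₂_same, List.mem_range]
    intro i hi
    exact (close_c₁_c₂_iff (two i) _ _).2 (hsat i hi)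
  -- (3) step from `(s₁, r₂)` to `(r₁, r₂)`
  have step3 : WidthLE 3000 (s₁ :: (gadget₁ φ n₁ A ++ (t₁ :: post₁)))
      (r₂ :: (clauseGadgets₂ φ n₁ B ++ (post₂ ++ [t₂', t₂]))) :=
    widthLE_cons_cons_iff.2 ⟨close_s₁_of_isGadget₂ (Or.inl rfl), Or.inr (Or.inl step4)⟩
  -- (2) stand on `s₁`, walk `P₂` to `AG(B)`
  have step2 : WidthLE 3000 (s₁ :: (gadget₁ φ n₁ A ++ (t₁ :: post₁)))
      ((s₂ :: s₂' :: pre₂) ++ r₂ :: (clauseGadgets₂ φ n₁ B ++ (post₂ ++ [t₂', t₂]))) := by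
    refine widthLE_cons_append (fun q hq => ?_) step3
    simp only [List.mem_cons] at hq
    rcases hq with rfl | rfl | hq
    · exact close_s₁_s₂
    · exact close_s₁_s₂'
    · exact close_s₁_of_isGadget₂ (hG₂ q (by simp [hq]))
  -- (1) stand on `s₂`, walk `P₁` to the block of `A`
  have step1 : WidthLE 3000 (pre₁ ++ s₁ :: (gadget₁ φ n₁ A ++ (t₁ :: post₁)))
      (s₂ :: (s₂' :: pre₂ ++ r₂ :: (clauseGadgets₂ φ n₁ B ++ (post₂ ++ [t₂', t₂])))) :=
    widthLE_append_cons (fun p hp => close_s₂_of_isQ₁ (hQ₁ p (by simp [hp]))) step2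
  rw [curveP₁, h₁, curveP₂, gadgets₂, h₂]
  simpa [block₁, gadget₂] using step1

/-- **Bringmann's reduction, discrete case (Lemmas 3.4 and 3.5):** for a CNF on at most `n₁ + n₂`
variables, `d_dF(P₁, P₂) ≤ τ` iff `φ` is satisfiable. [cite: BringmannFOCS2014, Lemmas 3.4–3.5] -/
theorem widthLE_curves_iff (hn : φ.numVars ≤ n₁ + n₂) :
    WidthLE 3000 (curveP₁ φ n₁) (curveP₂ φ n₁ n₂) ↔ φ.Satisfiable := by
  refine ⟨satisfiable_of_widthLE_curves, fun h => ?_⟩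
  obtain ⟨A, B, hA, hB, hAB⟩ := (satisfiable_iff_exists hn).1 h
  refine widthLE_curves_of_sat hA hB fun i hi => hAB _ ?_
  rw [List.getD_eq_getElem?_getD, List.getElem?_eq_getElem hi, Option.getD_some]
  exact List.getElem_mem hi

end correctness

/-! ### The instance of `DiscreteFrechetDecision` -/

section instance_

variable (φ : CNF ℕ) (n₁ n₂ : ℕ)

/-- The length of the first curve: `2^{n₁}` blocks of `M + 3` vertices. [folklore] -/
theorem length_curveP₁ : (curveP₁ φ n₁).length = 2 ^ n₁ * (φ.length + 3) := by
  simp [curveP₁, List.length_flatten, List.map_map, Function.comp_def, block₁, gadget₁,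
    List.sum_replicate, List.map_const']

/-- The length of the second curve: `2^{n₂}` gadgets of `M + 1` vertices, and `4` control
points. [folklore] -/
theorem length_curveP₂ : (curveP₂ φ n₁ n₂).length = 2 ^ n₂ * (φ.length + 1) + 4 := by
  simp [curveP₂, gadgets₂, List.length_flatten, List.map_map, Function.comp_def, gadget₂,
    List.sum_replicate, List.map_const']

/-- **Bringmann's instance**: the curves `P₁, P₂` of `φ` with squared threshold `τ² = 3000²`, as an
instance of `DiscreteFrechetDecision` (both curves are nonempty). [cite: BringmannFOCS2014, §3.1] -/
def frechetInstance : DiscreteFrechetDecision.Inst :=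
  ⟨⟨curveP₁ φ n₁, curveP₂ φ n₁ n₂, sqThreshold⟩, curveP₁_ne_nil, curveP₂_ne_nil⟩

/-- The size of Bringmann's instance is `|P₁| + |P₂|`. [folklore] -/
theorem size_frechetInstance : DiscreteFrechetDecision.size (frechetInstance φ n₁ n₂) =
    2 ^ n₁ * (φ.length + 3) + (2 ^ n₂ * (φ.length + 1) + 4) := by
  rw [← length_curveP₁, ← length_curveP₂]; rfl

/-- The encoding of Bringmann's instance. [folklore] -/
theorem encode_frechetInstance : DiscreteFrechetDecision.encode (frechetInstance φ n₁ n₂) =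
    FrechetInstance.encode ⟨curveP₁ φ n₁, curveP₂ φ n₁ n₂, sqThreshold⟩ := rfl

variable {φ n₁ n₂}

/-- The decision predicate of the zoo on Bringmann's instance is satisfiability of `φ`.
[cite: BringmannFOCS2014, Lemmas 3.4–3.5] -/
theorem discreteFrechet_curves_le_iff (hn : φ.numVars ≤ n₁ + n₂) :
    discreteFrechet (curveP₁ φ n₁) (curveP₂ φ n₁ n₂) ≤
        ((Real.sqrt (sqThreshold : ℕ) : ℝ) : WithTop ℝ) ↔ φ.Satisfiable := by
  rw [sqrt_sqThreshold]; exact widthLE_curves_iff hn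

open scoped Classical in
/-- **The accepted output on Bringmann's instance** is `[1]` iff `φ` is satisfiable, `[0]`
otherwise. [cite: BringmannFOCS2014, Lemmas 3.4–3.5] -/
theorem good_frechetInstance_iff (hn : φ.numVars ≤ n₁ + n₂) (out : List ℕ) :
    out ∈ DiscreteFrechetDecision.Good (frechetInstance φ n₁ n₂) ↔
      out = [if φ.Satisfiable then 1 else 0] := by
  have key := discreteFrechet_curves_le_iff (n₁ := n₁) (n₂ := n₂) hn
  change out ∈ (FGProblem.ofPred FrechetInstance.encode (fun I => I.P.length + I.Q.length)
    fun I => discreteFrechet I.P I.Q ≤ ((Real.sqrt I.sqThreshold : ℝ) : WithTop ℝ)).Good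
    ⟨curveP₁ φ n₁, curveP₂ φ n₁ n₂, sqThreshold⟩ ↔ _
  by_cases h : φ.Satisfiable
  · have hp := key.2 h
    simp [FGProblem.ofPred, hp, h]
  · have hp := mt key.1 h
    simp [FGProblem.ofPred, hp, h]

end instance_

end FrechetRed

end Literature.Computability.FineGrained
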